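import Summits.BirchSwinnertonDyer.Rank1Residual.ManinAdditive.ConwayNortonTwistAtThreeProofs
import Literature.NumberTheory.EllipticCurves.HeckeOperatorsAdjointProofs
import Literature.NumberTheory.EllipticCurves.CuspFormLFunctionLevelConductorProofs
import HarnessLib

/-!
# E-desc-54 `TranslationStableIndexTwistInvariance` HOLDS: the `f`-line index of the translation-stable lattice
# `S^T(N)` is invariant under the same-level `χ₋₃`-twist (`9 ∣ N`) — via Petersson self-adjointness of `B₃`

Summit `BirchSwinnertonDyer`, sub-problem `BirchSwinnertonDyer`, route `ManinLocalTwoThree` (Manin constant at the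
additive primes `2, 3`); width seat `bsd-line-manin23-p2` (gen 8), `--supports` the crux C3
`ManinPrimeToThreeAtNine` (stmt-BirchSwinnertonDyer-22968).  Cell `bsd-f2-manin`, descent lens desc g8 (MEMO-desc §25,
typed leaf `…ManinAdditive.ConwayNortonThree`, p636155), refuter-1 §R64 R-2 land order «E-desc-51′ (typer, p636828:
`twistOperatorEqCharTwist_holds`), THEN E-desc-54 (pure `B₃` transport, RB72.7), then E-desc-52».  This file is the
second step.

PROVED here (sorry-free, axioms standard):

* `cuspHeckeOperator_adjugate_thirdTranslateGL` — the adjugate `(3 −j; 0 3)` of `t_{j/3} = (3 j; 0 3)` is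
  `T⁻¹ · (3 j'; 0 3)` with `j + j' = 3`, so `[Γ₀(N) adj(t_{j/3}) Γ₀(N)] = [Γ₀(N) t_{j'/3} Γ₀(N)]` (any `N`);
* `peterssonProduct_thirdTranslate_left` — **`⟨t_{j/3} u, v⟩ = ⟨u, t_{j'/3} v⟩`** (Diamond–Shurman Prop. 5.5.2(b),
  tree `cuspHeckeOperator_adjoint`);
* `conj_zeta3`, `conj_zeta3_sub_sq` — `conj ζ₃ = ζ₃²`, `conj (ζ₃ − ζ₃²) = −(ζ₃ − ζ₃²)`;
* `peterssonProduct_twistOperatorAtThree_left` — **`B₃ = (t_{1/3} − t_{2/3})/(ζ₃ − ζ₃²)` is Petersson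
  SELF-ADJOINT** on `S_k(Γ₀(N))`, every `N`, every `k`;
* `lineIndex_eq_of_twistOperatorAtThree_swap` — for ANY `B₃`-stable `ℤ`-lattice `M` and any pair `B₃ f = g`,
  `B₃ g = f`: `lineIndex M f = lineIndex M g` (`B₃` induces mutually inverse bijections
  `M ⧸ (ℤ f + M ∩ f^⊥) ⇄ M ⧸ (ℤ g + M ∩ g^⊥)`; the composite is induced by `B₃²`, which is `≡ id` modulo `M ∩ f^⊥`
  because `⟨f, B₃² x − x⟩ = ⟨B₃² f − f, x⟩ = 0`; the junk case of an infinite quotient is covered, `0 = 0`);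
* `map_twistOperatorAtThree_translationStableLatticeAtThree_le` — `S^T(N)` is `B₃`-stable;
* `cuspCoeff_eq_zero_of_three_dvd_of_isNewform0`, `twistOperatorAtThree_charTwist_of_isNewform0` — a newform at
  `9 ∣ N` is `3`-depleted, hence `B₃ (f ⊗ χ₋₃) = f`;
* **`translationStableIndexTwistInvariance_holds : TranslationStableIndexTwistInvariance`** (E-desc-54 BY NAME; the
  leaf's second newform hypothesis `IsNewform0 (f ⊗ χ)` is not used).

Elementary (Atkin–Lehner 1970 §4 normaliser bookkeeping + Diamond–Shurman §5.5 adjoints); E-blind.  BSD is not proved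
by this; Manin's conjecture is not proved by this.
-/

set_option autoImplicit false
-- `Summit.BirchSwinnertonDyer.BirchSwinnertonDyer` is the mandated summit-side namespace (single-conjunct summit).
set_option linter.dupNamespace false

noncomputable section

open scoped MatrixGroups ModularForm ComplexConjugate
open CongruenceSubgroup Matrix.SpecialLinearGroup
open Literature.NumberTheory.EllipticCurves Literature.NumberTheory.EllipticCurves.ModularForms
open Summit.BirchSwinnertonDyer.Rank1Residual.ManinAdditive
open Summit.BirchSwinnertonDyer.Rank1Residual.ManinAdditive.RamanujanCut
open Summit.BirchSwinnertonDyer.Rank1Residual.ManinAdditive.ConwayNortonThree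

namespace Summit.BirchSwinnertonDyer.BirchSwinnertonDyer.Theorems.ManinLocalTwoThree

variable {N : ℕ} [NeZero N]

omit [NeZero N] in
/-- `T⁻¹ = (1 −1; 0 1) ∈ Γ₀(N)`. -/
theorem modularT_inv_mem_Gamma0 : ModularGroup.T⁻¹ ∈ Gamma0 N := by
  rw [Gamma0_mem, ModularGroup.coe_T_inv]
  simp

/-- The rational matrix of `thirdTranslateGL j` is `(3 j; 0 3)`. -/
theorem coe_coe_thirdTranslateGL (j : ℕ) :
    ((thirdTranslateGL j : GL (Fin 2) ℚ) : Matrix (Fin 2) (Fin 2) ℚ) = !![3, (j : ℚ); 0, 3] := by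
  simp [thirdTranslateGL, Matrix.GeneralLinearGroup.mkOfDetNeZero]

/-- **The adjugate of `t_{j/3}` is `Γ₀(N)`-equivalent to `t_{j'/3}` for `j + j' = 3`**: if `α' ∈ GL₂⁺(ℚ)` has matrix
`adj (3 j; 0 3) = (3 −j; 0 3)`, then `α' = (1 −1; 0 1) · (3 j'; 0 3)`, so the double-coset operators agree. -/
theorem cuspHeckeOperator_adjugate_thirdTranslateGL (k : ℤ) {j j' : ℕ} (hjj : j + j' = 3) (α' : GL(2, ℚ)⁺)
    (hα' : ((α' : GL (Fin 2) ℚ) : Matrix (Fin 2) (Fin 2) ℚ) =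
      ((thirdTranslateGL j : GL (Fin 2) ℚ) : Matrix (Fin 2) (Fin 2) ℚ).adjugate) :
    cuspHeckeOperatorₗ (Gamma0 N) k α' = cuspHeckeOperatorₗ (Gamma0 N) k (thirdTranslateGL j') := by
  have hmat : ((α' : GL (Fin 2) ℚ) : Matrix (Fin 2) (Fin 2) ℚ) = !![3, -(j : ℚ); 0, 3] := by
    rw [hα', coe_coe_thirdTranslateGL, Matrix.adjugate_fin_two]
    ext i j''
    fin_cases i <;> fin_cases j'' <;> simp
  have hj' : (j' : ℚ) = 3 - j := by
    have : ((j + j' : ℕ) : ℚ) = 3 := by rw [hjj]; norm_num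
    push_cast at this
    linarith
  have h : glCast (α' : GL (Fin 2) ℚ) =
      (mapGL ℝ (ModularGroup.T⁻¹) : GL (Fin 2) ℝ) * glCast (thirdTranslateGL j' : GL (Fin 2) ℚ) * 1 := by
    rw [mul_one]
    apply Matrix.GeneralLinearGroup.ext
    intro i i'
    simp only [Matrix.GeneralLinearGroup.coe_mul, val_glCast_thirdTranslateGL, val_mapGL', ModularGroup.coe_T_inv]
    rw [show ((glCast (α' : GL (Fin 2) ℚ) : GL (Fin 2) ℝ) : Matrix (Fin 2) (Fin 2) ℝ) =
      ((α' : GL (Fin 2) ℚ) : Matrix (Fin 2) (Fin 2) ℚ).map (Rat.castHom ℝ) from rfl, hmat]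
    have hj'R : (j' : ℝ) = 3 - (j : ℝ) := by exact_mod_cast hj'
    fin_cases i <;> fin_cases i' <;>
      simp [Matrix.mul_apply, Fin.sum_univ_two, Matrix.map_apply]
    linarith [hj'R]
  refine LinearMap.ext fun f => ?_
  change cuspHeckeCorrespondence (Gamma0 N) (Gamma0 N) k (α' : GL (Fin 2) ℚ) f =
    cuspHeckeCorrespondence (Gamma0 N) (Gamma0 N) k (thirdTranslateGL j' : GL (Fin 2) ℚ) f
  rw [cuspHeckeCorrespondence_eq_of_eq_mul (Gamma0 N) (Gamma0 N) k
    (Subgroup.mem_map_of_mem (mapGL ℝ) modularT_inv_mem_Gamma0) (one_mem _) h]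


omit [NeZero N] in
/-- `Γ₀(N) ≤ SL(2, ℤ)` inside `GL(2, ℝ)`. -/
theorem gamma0_le_SL : (Gamma0 N : Subgroup (GL (Fin 2) ℝ)) ≤ 𝒮ℒ :=
  Subgroup.map_le_range _ _

/-- **`t_{j/3}` and `t_{j'/3}` are Petersson-adjoint for `j + j' = 3`**: `⟨t_{j/3} u, v⟩ = ⟨u, t_{j'/3} v⟩`
(Diamond–Shurman Prop. 5.5.2(b) `[ΓαΓ]^* = [Γα'Γ]`, `α' = adj α`, plus `cuspHeckeOperator_adjugate_thirdTranslateGL`; the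
scalar `9^{1−k/2}` is real).  No hypothesis on `N`. -/
theorem peterssonProduct_thirdTranslate_left (k : ℤ) {j j' : ℕ} (hjj : j + j' = 3) (u v : CuspForm (Gamma0 N) k) :
    peterssonProduct (Gamma0 N) k (thirdTranslate N k j u) v =
      peterssonProduct (Gamma0 N) k u (thirdTranslate N k j' v) := by
  obtain ⟨α', hα'⟩ := exists_coe_coe_eq_adjugate (thirdTranslateGL j)
  have hadj := cuspHeckeOperator_adjoint (Gamma0 N) gamma0_le_SL k (thirdTranslateGL j) α' hα' u v
  rw [cuspHeckeOperator_adjugate_thirdTranslateGL k hjj α' hα'] at hadj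
  simp only [thirdTranslate, LinearMap.smul_apply, peterssonProduct_smul_left, peterssonProduct_smul_right,
    Complex.conj_ofReal, hadj]

/-- `conj ζ₃ = ζ₃²`. -/
theorem conj_zeta3 : conj zeta3 = zeta3 ^ 2 := by
  have h3 : zeta3 ^ 3 = 1 := isPrimitiveRoot_zeta3.pow_eq_one
  have hconj : conj zeta3 = zeta3⁻¹ := by
    rw [zeta3, ← Complex.exp_conj, ← Complex.exp_neg]
    congr 1
    simp only [map_div₀, map_mul, map_ofNat, Complex.conj_ofReal, Complex.conj_I]
    ring
  rw [hconj]
  exact inv_eq_of_mul_eq_one_right (by rw [← pow_succ', h3])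

/-- `conj (ζ₃ − ζ₃²) = −(ζ₃ − ζ₃²)` (`ζ₃ − ζ₃² = √−3` is purely imaginary). -/
theorem conj_zeta3_sub_sq : conj (zeta3 - zeta3 ^ 2) = -(zeta3 - zeta3 ^ 2) := by
  have h3 : zeta3 ^ 3 = 1 := isPrimitiveRoot_zeta3.pow_eq_one
  rw [map_sub, map_pow, conj_zeta3]
  linear_combination (-zeta3) * h3

/-- `⟨f₁ − f₂, g⟩ = ⟨f₁, g⟩ − ⟨f₂, g⟩`. -/
theorem peterssonProduct_sub_left' {Γ : Subgroup (GL (Fin 2) ℝ)} [Γ.IsArithmetic] [Γ.HasDetOne] (k : ℤ)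
    (f₁ f₂ g : CuspForm Γ k) :
    peterssonProduct Γ k (f₁ - f₂) g = peterssonProduct Γ k f₁ g - peterssonProduct Γ k f₂ g := by
  have h := peterssonProduct_add_left Γ k (f₁ - f₂) f₂ g
  rw [sub_add_cancel] at h
  rw [h, add_sub_cancel_right]

/-- `⟨f, g₁ − g₂⟩ = ⟨f, g₁⟩ − ⟨f, g₂⟩`. -/
theorem peterssonProduct_sub_right' {Γ : Subgroup (GL (Fin 2) ℝ)} [Γ.IsArithmetic] [Γ.HasDetOne] (k : ℤ)
    (f g₁ g₂ : CuspForm Γ k) :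
    peterssonProduct Γ k f (g₁ - g₂) = peterssonProduct Γ k f g₁ - peterssonProduct Γ k f g₂ := by
  have h := (peterssonProductₗ Γ k f).map_sub g₁ g₂
  simpa only [peterssonProductₗ_apply] using h

/-- **`B₃` is Petersson-self-adjoint**: `⟨B₃ u, v⟩ = ⟨u, B₃ v⟩` on `S_k(Γ₀(N))` (any `N`):
`B₃ = (t_{1/3} − t_{2/3})/(ζ₃ − ζ₃²)`, `t_{1/3}^* = t_{2/3}`, and `conj (ζ₃ − ζ₃²) = −(ζ₃ − ζ₃²)`. -/
theorem peterssonProduct_twistOperatorAtThree_left (k : ℤ) (u v : CuspForm (Gamma0 N) k) :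
    peterssonProduct (Gamma0 N) k (twistOperatorAtThree N k u) v =
      peterssonProduct (Gamma0 N) k u (twistOperatorAtThree N k v) := by
  have h1 := peterssonProduct_thirdTranslate_left k (show 1 + 2 = 3 by norm_num) u v
  have h2 := peterssonProduct_thirdTranslate_left k (show 2 + 1 = 3 by norm_num) u v
  simp only [twistOperatorAtThree, LinearMap.smul_apply, LinearMap.sub_apply]
  rw [peterssonProduct_smul_left, peterssonProduct_smul_right, peterssonProduct_sub_left',
    peterssonProduct_sub_right', map_inv₀, conj_zeta3_sub_sq, h1, h2, inv_neg]
  ring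

/-! ### The `f`-line index of a `B₃`-stable lattice is invariant under `f ↔ B₃ f` -/

/-- **The `f`-line index `#(M ⧸ (ℤ f + M ∩ f^⊥))` of a `B₃`-stable `ℤ`-lattice `M` is the same along `f` and along `g`
whenever `B₃ f = g` and `B₃ g = f`.**  `B₃` restricts to `M →ₗ[ℤ] M`; by self-adjointness it maps `ℤ f + M ∩ f^⊥` into
`ℤ g + M ∩ g^⊥` (`⟨g, B₃ z⟩ = ⟨B₃ g, z⟩ = ⟨f, z⟩ = 0`) and vice versa, and `B₃² ≡ id` modulo `M ∩ f^⊥` on `M`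
(`⟨f, B₃² x − x⟩ = ⟨B₃² f, x⟩ − ⟨f, x⟩ = 0`); so the two induced maps between the quotients are mutually inverse
bijections and the cardinalities agree (including the infinite junk case `0 = 0`). -/
theorem lineIndex_eq_of_twistOperatorAtThree_swap {M : Submodule ℤ (CuspForm (Gamma0 N) 2)}
    (hM : M.map ((twistOperatorAtThree N 2).restrictScalars ℤ) ≤ M) {f g : CuspForm (Gamma0 N) 2}
    (hf : twistOperatorAtThree N 2 f = g) (hg : twistOperatorAtThree N 2 g = f) : lineIndex M f = lineIndex M g := by
  -- the relative kernels `K h = ℤ h + M ∩ h^⊥` (inside `M`) and the restriction `BM` of `B₃` to `M`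
  let K : CuspForm (Gamma0 N) 2 → Submodule ℤ M := fun h =>
    ((ℤ ∙ h) ⊔ (M ⊓ (LinearMap.ker (peterssonProductₗ (Gamma0 N) 2 h)).restrictScalars ℤ)).comap M.subtype
  let BM : M →ₗ[ℤ] M := ((twistOperatorAtThree N 2).restrictScalars ℤ).restrict fun x hx => hM ⟨x, hx, rfl⟩
  have hBM : ∀ x : M, ((BM x : M) : CuspForm (Gamma0 N) 2) = twistOperatorAtThree N 2 x := fun x => rfl
  have hK : ∀ (h : CuspForm (Gamma0 N) 2) (x : M), x ∈ K h ↔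
      (x : CuspForm (Gamma0 N) 2) ∈ (ℤ ∙ h) ⊔ (M ⊓ (LinearMap.ker (peterssonProductₗ (Gamma0 N) 2 h)).restrictScalars ℤ) :=
    fun h x => Submodule.mem_comap
  -- (1) `B₃` maps `K f'` into `K g'` whenever `B₃ f' = g'`, `B₃ g' = f'`
  have key : ∀ f' g' : CuspForm (Gamma0 N) 2, twistOperatorAtThree N 2 f' = g' → twistOperatorAtThree N 2 g' = f' →
      K f' ≤ (K g').comap BM := by
    intro f' g' hf' hg' x hx
    rw [Submodule.mem_comap, hK, hBM]
    rw [hK] at hx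
    obtain ⟨y, hy, z, hz, hyz⟩ := Submodule.mem_sup.mp hx
    obtain ⟨a, rfl⟩ := Submodule.mem_span_singleton.mp hy
    obtain ⟨hzM, hzk⟩ := Submodule.mem_inf.mp hz
    rw [← hyz, map_add, map_zsmul, hf']
    refine Submodule.mem_sup.mpr ⟨a • g', Submodule.mem_span_singleton.mpr ⟨a, rfl⟩, twistOperatorAtThree N 2 z,
      Submodule.mem_inf.mpr ⟨hM ⟨z, hzM, rfl⟩, ?_⟩, rfl⟩
    rw [Submodule.restrictScalars_mem, LinearMap.mem_ker, peterssonProductₗ_apply] at hzk ⊢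
    rw [← peterssonProduct_twistOperatorAtThree_left, hg', hzk]
  -- (2) `B₃² x − x ∈ K f'` for `x ∈ M`
  have key2 : ∀ f' g' : CuspForm (Gamma0 N) 2, twistOperatorAtThree N 2 f' = g' → twistOperatorAtThree N 2 g' = f' →
      ∀ x : M, BM (BM x) - x ∈ K f' := by
    intro f' g' hf' hg' x
    rw [hK]
    refine Submodule.mem_sup_right (Submodule.mem_inf.mpr ⟨(BM (BM x) - x).2, ?_⟩)
    rw [Submodule.restrictScalars_mem, LinearMap.mem_ker, peterssonProductₗ_apply, Submodule.coe_sub, hBM, hBM,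
      peterssonProduct_sub_right', ← peterssonProduct_twistOperatorAtThree_left,
      ← peterssonProduct_twistOperatorAtThree_left, hf', hg', sub_self]
  -- (3) the mutually inverse induced maps
  change Nat.card (M ⧸ K f) = Nat.card (M ⧸ K g)
  refine Nat.card_congr
    { toFun := (K f).mapQ (K g) BM (key f g hf hg)
      invFun := (K g).mapQ (K f) BM (key g f hg hf)
      left_inv := fun q => ?_
      right_inv := fun q => ?_ }
  · induction q using Submodule.Quotient.induction_on with
    | H x => exact (Submodule.Quotient.eq _).mpr (key2 f g hf hg x)
  · induction q using Submodule.Quotient.induction_on with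
    | H x => exact (Submodule.Quotient.eq _).mpr (key2 g f hg hf x)

/-! ### E-desc-54: the translation-stable lattice `S^T(N)` and the same-level `χ₋₃`-twist -/

/-- **`S^T(N)` is `B₃`-stable** (it is the largest `⟨w_Q, A₃, B₃⟩`-stable sublattice of `S₂(Γ₀(N); ℤ)`: a supremum of
`B₃`-stable lattices is `B₃`-stable). -/
theorem map_twistOperatorAtThree_translationStableLatticeAtThree_le :
    (translationStableLatticeAtThree N).map ((twistOperatorAtThree N 2).restrictScalars ℤ) ≤
      translationStableLatticeAtThree N := by
  unfold translationStableLatticeAtThree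
  rw [Submodule.map_le_iff_le_comap]
  exact sSup_le fun M hM => Submodule.map_le_iff_le_comap.mp (hM.2.2.2.trans (le_sSup hM))

/-- A newform on `Γ₀(N)` with `9 ∣ N` is `3`-depleted: `aₙ(f) = 0` for `3 ∣ n` (`a₃ = 0` by Atkin–Lehner since `3² ∣ N`,
and `a_{3m} = a₃ a_m` by `U₃`). [cite: AtkinLehner1970, Thm. 3] -/
theorem cuspCoeff_eq_zero_of_three_dvd_of_isNewform0 {k : ℤ} {f : CuspForm (Gamma0 N) k} (hf : IsNewform0 f)
    (h9 : 9 ∣ N) {n : ℕ} (hn : 3 ∣ n) : cuspCoeff f n = 0 := by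
  obtain ⟨n', rfl⟩ := hn
  have h3N : 3 ∣ N := (show (3 : ℕ) ∣ 9 by norm_num).trans h9
  rw [hf.cuspCoeff_prime_mul Nat.prime_three n', if_pos h3N, sub_zero,
    hf.cuspCoeff_eq_zero_of_sq_dvd Nat.prime_three (by simpa using h9), zero_mul]

/-- **`B₃ (f ⊗ χ₋₃) = f` for a newform `f` on `Γ₀(N)`, `9 ∣ N`**: `aₙ(B₃(f ⊗ χ)) = χ(n)² aₙ(f)`, which is `aₙ(f)` for
`3 ∤ n` (`χ` quadratic) and `0 = aₙ(f)` for `3 ∣ n` (`f` is `3`-depleted). -/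
theorem twistOperatorAtThree_charTwist_of_isNewform0 (h9 : 3 ^ 2 ∣ N) {χ : DirichletCharacter ℂ 3}
    (hχ : χ.IsQuadratic) (hprim : χ.IsPrimitive) {f : CuspForm (Gamma0 N) 2} (hf : IsNewform0 f) :
    twistOperatorAtThree N 2 (charTwist N dvd_rfl h9 hχ f) = f := by
  have h9' : 9 ∣ N := by simpa using h9
  refine eq_of_forall_cuspCoeff_eq_gamma0 fun n => ?_
  rw [cuspCoeff_twistOperatorAtThree_two h9' hχ hprim,
    cuspCoeff_charTwist (L := N) (hN := dvd_rfl) (hm := h9) (hχ := hχ) (hprim := hprim) (f := f) (n := n)]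
  by_cases hn : 3 ∣ n
  · rw [cuspCoeff_eq_zero_of_three_dvd_of_isNewform0 hf h9' hn, mul_zero, mul_zero]
  · have hu : IsUnit ((n : ℕ) : ZMod 3) := by
      rw [ZMod.isUnit_iff_coprime]
      exact Nat.coprime_comm.mp ((Nat.Prime.coprime_iff_not_dvd Nat.prime_three).mpr hn)
    rw [← mul_assoc, ← sq, apply_sq_eq_one_of_isQuadratic hχ hu, one_mul]

/-- **E-desc-54 `TranslationStableIndexTwistInvariance` HOLDS** (cell `bsd-f2-manin`, desc g8 theorem target, refuter-1
§R64 «VALID on paper UNCONDITIONALLY»): for `9 ∣ N` and a newform `f` whose `χ₋₃`-twist `f ⊗ χ` has level `N`, the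
`f`-line indices of the translation-stable lattice `S^T(N)` along `f` and along `f ⊗ χ` are equal.  Proof: `S^T` is
`B₃`-stable, `B₃ f = f ⊗ χ` (E-desc-51′, `twistOperatorEqCharTwist_holds`), `B₃ (f ⊗ χ) = f`, and `B₃` is Petersson
self-adjoint, so `B₃` induces mutually inverse bijections between the two quotients `S^T ⧸ (ℤ h + S^T ∩ h^⊥)`,
`h ∈ {f, f ⊗ χ}` (the second newform hypothesis is not even used).  BSD is not proved by this; Manin's conjecture is
not proved by this. -/
theorem translationStableIndexTwistInvariance_holds : TranslationStableIndexTwistInvariance := by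
  intro N _ h9 χ hχ hprim f hf _
  exact lineIndex_eq_of_twistOperatorAtThree_swap map_twistOperatorAtThree_translationStableLatticeAtThree_le
    (twistOperatorEqCharTwist_holds N h9 χ hχ hprim f) (twistOperatorAtThree_charTwist_of_isNewform0 h9 hχ hprim hf)

end Summit.BirchSwinnertonDyer.BirchSwinnertonDyer.Theorems.ManinLocalTwoThree

end
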